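import Summits.KontsevichZagierPeriods.KontsevichZagierPeriods.Theses.HermiteRigidity
import Literature.NumberTheory.Transcendental.KZRelationsLE

/-!
# KontsevichZagierPeriods / HermiteRigidity — the assembly `Assembly` (stmt-KontsevichZagierPeriods-3417)
# and its algebraic input `RigidKernel` (stmt-KontsevichZagierPeriods-10633): rigidity ⇒ kernel

Route `KontsevichZagierPeriods/HermiteRigidity` (Hermite reduction as moves + 1-motivic rigidity),
item stmt-KontsevichZagierPeriods-3417 (`Assembly`, rank 1):

  `ReductionRigidity → KontsevichZagierPeriods`.

REDUCTION + RIGIDITY decide Conjecture 1. Given rational-shape representations `r, r'` with equal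
values, REDUCTION gives `x, x' ∈ N(B)` (the rescaling subgroup of the rigid family `B`) with
`[r] − x, [r'] − x' ∈ KZ.relations`; soundness of the calculus (`KZ.relations_le_ker_eval_holds`)
gives `eval x = value r = value r' = eval x'`, so `x − x' ∈ N(B) ∩ ker eval`, which lies in
`KZ.relations` by RIGIDITY ⇒ KERNEL (the route's support item `RigidKernel`, proved here as
`RigidKernel.rigidKernel_proof`); hence `[r] − [r'] = ([r] − x) − ([r'] − x') + (x − x') ∈
relations`. That deduction is VERBATIM the route's kernel-checked deciding theorem
`Summit.KontsevichZagierPeriods.KontsevichZagierPeriods.Theses.HermiteRigidity.closes :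
ReductionRigidity → RigidKernel → KontsevichZagierPeriods` (route file rev 4, D-0027 §2.1), so the
item is `closes` fed with `rigidKernel_proof` (`Assembly.assembly_proof`). The antecedent
`ReductionRigidity` (the route's rank-0 target, summit-strength: kernel form ⇒ X ⇒ Statement) is
NOT discharged here: the theorem is the implication, nothing more.

## `RigidKernel` (stmt-KontsevichZagierPeriods-10633) — rigidity ⇒ kernel

For ANY family `B` of integral representations whose values are linearly independent over the real
algebraic numbers (the RIGIDITY clause of `ReductionRigidity`, verbatim: for every finset `F ⊆ B`
and real algebraic coefficients `β`, `∑_{b ∈ F} β b · value b = 0` forces `β = 0` on `F`), every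
element of the rescaling subgroup
`N(B) = closure {[s] : s.domain = b.domain, s.integrand = β · b.integrand on it, β real algebraic, b ∈ B}`
of value `0` lies in `KZ.relations`.

Proof (bookkeeping in the free abelian group `KZ.FormalRep` modulo `KZ.relations`, i.e. in the
quotient `KZ.FormalRep ⧸ KZ.relations`): by closure induction every `x ∈ N(B)` has a NORMAL FORM
`x ≡ ∑_{b ∈ F} [b.constMul (β b)]` (`KZ.IntegralRep.constMul`: same domain, integrand `β b · f`)
with `F ⊆ B` finite and `β` real algebraic, vanishing off `F` (`RigidKernel.exists_normalForm`): a
generator `[s]` is congruent to `[b.constMul β]` (same domain, integrands agree on it: one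
integrand-additivity move with the zero copy `[b.constMul 0]`, itself a relation); sums merge
coefficientwise because `[σ, (a + a') f] − [σ, a f] − [σ, a' f]` IS an integrand-additivity move
(rule 1b), and negation is `[σ, (−a) f] ≡ −[σ, a f]` for the same reason. If `eval x = 0`, the
soundness of the calculus and `value (b.constMul a) = a · value b` give
`∑_{b ∈ F} β b · value b = 0`, RIGIDITY gives `β = 0` on `F`, so every summand of the normal form
has integrand `0 · f = 0` on its domain and is a relation; hence `x ∈ KZ.relations`.

References: M. Kontsevich, D. Zagier, *Periods* (2001), §1.2 (Conjecture 1, rules 1)–3));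
A. Huber, S. Müller-Stach, *Periods and Nori Motives* (2017), §13.1.
-/

noncomputable section

open Set

namespace Summit.KontsevichZagierPeriods.HermiteRigidity.RigidKernel

open Literature.NumberTheory.Transcendental

variable {n : ℕ}

/-- A copy rescaled by `a = 0`, `[σ, 0 · f]`, is a relation: its integrand vanishes on the domain,
so `[σ,0f] − [σ,0f] − [σ,0f]` is an integrand-additivity move (rule 1b).
[Kontsevich–Zagier 2001, §1.2, rule 1)] [folklore] -/
theorem of_constMul_mem_relations_of_eq_zero (r : KZ.IntegralRep n) {a : ℝ}
    (ha : IsAlgebraic ℚ a) (h0 : a = 0) : KZ.of (r.constMul a ha) ∈ KZ.relations := by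
  subst h0
  have h : KZ.of (r.constMul 0 ha) - KZ.of (r.constMul 0 ha) - KZ.of (r.constMul 0 ha) ∈
      KZ.relations :=
    KZ.integrandAddRel_subset_relations
      ⟨n, r.constMul 0 ha, r.constMul 0 ha, r.constMul 0 ha, rfl, rfl, fun x _ => by simp, rfl⟩
  rw [sub_self, zero_sub] at h
  exact neg_mem_iff.mp h

/-- **Additivity in the scalar is rule 1b**: `[σ, (a + a') f] − [σ, a f] − [σ, a' f]` is an
integrand-additivity move, hence a relation. [Kontsevich–Zagier 2001, §1.2, rule 1)] [folklore] -/
theorem of_constMul_add_sub_sub_mem_relations (r : KZ.IntegralRep n) {a a' : ℝ}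
    (ha : IsAlgebraic ℚ a) (ha' : IsAlgebraic ℚ a') (hadd : IsAlgebraic ℚ (a + a')) :
    KZ.of (r.constMul (a + a') hadd) - KZ.of (r.constMul a ha) - KZ.of (r.constMul a' ha') ∈
      KZ.relations :=
  KZ.integrandAddRel_subset_relations
    ⟨n, r.constMul (a + a') hadd, r.constMul a ha, r.constMul a' ha', rfl, rfl,
      fun x _ => by simp [add_mul], rfl⟩

/-- In the quotient `KZ.FormalRep ⧸ KZ.relations` the class of a rescaled copy is additive in the
scalar: `⟦[σ, (a + a') f]⟧ = ⟦[σ, a f]⟧ + ⟦[σ, a' f]⟧`. [Kontsevich–Zagier 2001, §1.2, rule 1)]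
[folklore] -/
theorem mk_of_constMul_add (r : KZ.IntegralRep n) {a a' : ℝ}
    (ha : IsAlgebraic ℚ a) (ha' : IsAlgebraic ℚ a') (hadd : IsAlgebraic ℚ (a + a')) :
    QuotientAddGroup.mk' KZ.relations (KZ.of (r.constMul (a + a') hadd)) =
      QuotientAddGroup.mk' KZ.relations (KZ.of (r.constMul a ha)) +
        QuotientAddGroup.mk' KZ.relations (KZ.of (r.constMul a' ha')) := by
  have h := of_constMul_add_sub_sub_mem_relations r ha ha' hadd
  rw [← QuotientAddGroup.ker_mk' KZ.relations, AddMonoidHom.mem_ker, map_sub, map_sub, sub_sub,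
    sub_eq_zero] at h
  exact h

/-- In the quotient `KZ.FormalRep ⧸ KZ.relations` the class of the copy rescaled by `0` vanishes.
[Kontsevich–Zagier 2001, §1.2, rule 1)] [folklore] -/
theorem mk_of_constMul_eq_zero (r : KZ.IntegralRep n) {a : ℝ} (ha : IsAlgebraic ℚ a)
    (h0 : a = 0) : QuotientAddGroup.mk' KZ.relations (KZ.of (r.constMul a ha)) = 0 := by
  rw [← AddMonoidHom.mem_ker, QuotientAddGroup.ker_mk']
  exact of_constMul_mem_relations_of_eq_zero r ha h0

/-- In the quotient `KZ.FormalRep ⧸ KZ.relations`, rescaling by `−a` is the negative of rescaling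
by `a`: `⟦[σ, (−a) f]⟧ = −⟦[σ, a f]⟧` (from additivity in the scalar and the vanishing of the
`0`-copy). [Kontsevich–Zagier 2001, §1.2, rule 1)] [folklore] -/
theorem mk_of_constMul_neg (r : KZ.IntegralRep n) {a : ℝ} (ha : IsAlgebraic ℚ a)
    (hna : IsAlgebraic ℚ (-a)) :
    QuotientAddGroup.mk' KZ.relations (KZ.of (r.constMul (-a) hna)) =
      -QuotientAddGroup.mk' KZ.relations (KZ.of (r.constMul a ha)) := by
  have h := mk_of_constMul_add r ha hna (ha.add hna)
  rw [mk_of_constMul_eq_zero r (ha.add hna) (add_neg_cancel a)] at h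
  exact eq_neg_of_add_eq_zero_right h.symm

/-- **Generators of `N(B)` are rescaled copies, modulo relations**: if `s` has the domain of `b`
and integrand `a · b.integrand` ON that domain, then `⟦[s]⟧ = ⟦[b.constMul a]⟧` (one
integrand-additivity move `[s] − [b.constMul a] − [b.constMul 0]` plus the vanishing `0`-copy).
[Kontsevich–Zagier 2001, §1.2, rule 1)] [folklore] -/
theorem mk_of_eq_mk_of_constMul {b s : KZ.IntegralRep n} {a : ℝ} (ha : IsAlgebraic ℚ a)
    (hd : s.domain = b.domain) (hi : EqOn s.integrand (fun p => a * b.integrand p) s.domain) :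
    QuotientAddGroup.mk' KZ.relations (KZ.of s) =
      QuotientAddGroup.mk' KZ.relations (KZ.of (b.constMul a ha)) := by
  have h1 : KZ.of s - KZ.of (b.constMul a ha) - KZ.of (b.constMul 0 isAlgebraic_zero) ∈
      KZ.relations :=
    KZ.integrandAddRel_subset_relations
      ⟨n, s, b.constMul a ha, b.constMul 0 isAlgebraic_zero, hd.symm, hd.symm,
        fun x hx => by simp [hi hx], rfl⟩
  rw [← QuotientAddGroup.ker_mk' KZ.relations, AddMonoidHom.mem_ker, map_sub, map_sub,
    mk_of_constMul_eq_zero b isAlgebraic_zero rfl, sub_zero, sub_eq_zero] at h1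
  exact h1

/-- **Normal form on the rescaling subgroup.** Every element `x` of
`N(B) = closure {[s] : s a real-algebraic rescaled copy of some b ∈ B on the same domain}` is
congruent modulo `KZ.relations` to `∑_{b ∈ F} [b.constMul (β b)]` for a finset `F ⊆ B` and real
algebraic coefficients `β` vanishing off `F` (closure induction: generators by
`mk_of_eq_mk_of_constMul`, sums merge coefficientwise by `mk_of_constMul_add`, negation by
`mk_of_constMul_neg`, padding by `0`-copies by `mk_of_constMul_eq_zero`).
[Kontsevich–Zagier 2001, §1.2, rule 1); Huber–Müller-Stach 2017, §13.1] [folklore] -/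
theorem exists_normalForm (B : Set (Σ n, KZ.IntegralRep n)) {x : KZ.FormalRep}
    (hx : x ∈ AddSubgroup.closure {c : KZ.FormalRep | ∃ b ∈ B, ∃ (s : KZ.IntegralRep b.1) (β : ℝ),
      IsAlgebraic ℚ β ∧ s.domain = b.2.domain ∧
        Set.EqOn s.integrand (fun p => β * b.2.integrand p) s.domain ∧ c = KZ.of s}) :
    ∃ (F : Finset (Σ n, KZ.IntegralRep n)) (β : (Σ n, KZ.IntegralRep n) → ℝ)
      (hβ : ∀ b, IsAlgebraic ℚ (β b)), (↑F ⊆ B) ∧ (∀ b ∉ F, β b = 0) ∧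
      QuotientAddGroup.mk' KZ.relations x =
        ∑ b ∈ F, QuotientAddGroup.mk' KZ.relations (KZ.of (b.2.constMul (β b) (hβ b))) := by
  classical
  induction hx using AddSubgroup.closure_induction with
  | mem c hc =>
    obtain ⟨b₀, hb₀, s, β₀, hβ₀, hd, hi, rfl⟩ := hc
    refine ⟨{b₀}, Pi.single b₀ β₀, fun b => ?_, by simpa using hb₀, fun b hb => ?_, ?_⟩
    · rcases eq_or_ne b b₀ with rfl | hne
      · simpa using hβ₀
      · rw [Pi.single_eq_of_ne hne]
        exact isAlgebraic_zero
    · have hne : b ≠ b₀ := by simpa using hb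
      exact Pi.single_eq_of_ne hne _
    · rw [Finset.sum_singleton]
      exact mk_of_eq_mk_of_constMul _ hd (fun p hp => by rw [hi hp, Pi.single_eq_same])
  | zero =>
    exact ⟨∅, 0, fun _ => isAlgebraic_zero, by simp, fun _ _ => rfl, by simp⟩
  | add x y _ _ ihx ihy =>
    obtain ⟨F₁, β₁, hβ₁, hF₁, hz₁, h₁⟩ := ihx
    obtain ⟨F₂, β₂, hβ₂, hF₂, hz₂, h₂⟩ := ihy
    refine ⟨F₁ ∪ F₂, β₁ + β₂, fun b => (hβ₁ b).add (hβ₂ b), ?_, ?_, ?_⟩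
    · rw [Finset.coe_union]
      exact Set.union_subset hF₁ hF₂
    · intro b hb
      rw [Finset.mem_union, not_or] at hb
      simp [hz₁ b hb.1, hz₂ b hb.2]
    · rw [map_add, h₁, h₂,
        Finset.sum_subset Finset.subset_union_left (fun b _ hb =>
          mk_of_constMul_eq_zero b.2 (hβ₁ b) (hz₁ b hb)),
        Finset.sum_subset Finset.subset_union_right (fun b _ hb =>
          mk_of_constMul_eq_zero b.2 (hβ₂ b) (hz₂ b hb)),
        ← Finset.sum_add_distrib]
      refine Finset.sum_congr rfl fun b _ => ?_
      exact (mk_of_constMul_add b.2 (hβ₁ b) (hβ₂ b) ((hβ₁ b).add (hβ₂ b))).symm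
  | neg x _ ihx =>
    obtain ⟨F, β, hβ, hF, hz, h⟩ := ihx
    refine ⟨F, -β, fun b => (hβ b).neg, hF, fun b hb => by simp [hz b hb], ?_⟩
    rw [map_neg, h, ← Finset.sum_neg_distrib]
    refine Finset.sum_congr rfl fun b _ => ?_
    exact (mk_of_constMul_neg b.2 (hβ b) (hβ b).neg).symm

/-- **`RigidKernel`** (item stmt-KontsevichZagierPeriods-10633 of route HermiteRigidity; the
missing hypothesis of the route's deciding theorem `closes`): for every family `B` of integral
representations whose values are linearly independent over the real algebraic numbers, every
element of the rescaling subgroup `N(B)` of value `0` is a relation of the Kontsevich–Zagier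
calculus. Proof: write `x ≡ ∑_{b ∈ F} [b.constMul (β b)]` (`exists_normalForm`); soundness of the
moves (`KZ.relations_le_ker_eval_holds`) and `KZ.IntegralRep.value_constMul` turn `eval x = 0` into
`∑_{b ∈ F} β b · value b = 0`; RIGIDITY gives `β = 0` on `F`; so each summand is a `0`-copy, a
relation (`of_constMul_mem_relations_of_eq_zero`), and `x = (x − ∑) + ∑ ∈ KZ.relations`.
[Kontsevich–Zagier 2001, §1.2; Huber–Müller-Stach 2017, §13.1] [folklore] -/
theorem rigidKernel_proof :
    Summit.KontsevichZagierPeriods.KontsevichZagierPeriods.Theses.HermiteRigidity.RigidKernel := by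
  unfold Summit.KontsevichZagierPeriods.KontsevichZagierPeriods.Theses.HermiteRigidity.RigidKernel
  intro B hB x hx hx0
  obtain ⟨F, β, hβ, hF, -, h⟩ := exists_normalForm B hx
  rw [← map_sum] at h
  have hsub : x - ∑ b ∈ F, KZ.of (b.2.constMul (β b) (hβ b)) ∈ KZ.relations := by
    rw [← QuotientAddGroup.ker_mk' KZ.relations, AddMonoidHom.mem_ker, map_sub, sub_eq_zero]
    exact h
  have heval : ∑ b ∈ F, β b * b.2.value = 0 := by
    have h1 := (AddMonoidHom.mem_ker).1 (KZ.relations_le_ker_eval_holds hsub)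
    rw [map_sub, hx0, zero_sub, neg_eq_zero, map_sum] at h1
    simpa only [KZ.eval_of, KZ.IntegralRep.value_constMul] using h1
  have hβ0 : ∀ b ∈ F, β b = 0 := hB F β hF (fun b _ => hβ b) heval
  have hsum : ∑ b ∈ F, KZ.of (b.2.constMul (β b) (hβ b)) ∈ KZ.relations :=
    sum_mem fun b hb => of_constMul_mem_relations_of_eq_zero b.2 (hβ b) (hβ0 b hb)
  have hx' : x = (x - ∑ b ∈ F, KZ.of (b.2.constMul (β b) (hβ b))) +
      ∑ b ∈ F, KZ.of (b.2.constMul (β b) (hβ b)) := by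
    abel
  rw [hx']
  exact add_mem hsub hsum

end Summit.KontsevichZagierPeriods.HermiteRigidity.RigidKernel

namespace Summit.KontsevichZagierPeriods.HermiteRigidity.Assembly

/-- **Assembly of route HermiteRigidity** (settles stmt-KontsevichZagierPeriods-3417):
`ReductionRigidity → KontsevichZagierPeriods`. Given a rigid reducing family `B` (values linearly
independent over the real algebraic numbers, every rational-shape representation reduced by moves
into the rescaling subgroup `N(B)`), any two rational-shape KZ representations with the same value
are KZ-equivalent. Proof: the route's deciding theorem `closes` together with the proved support
item `RigidKernel` (`RigidKernel.rigidKernel_proof` above: `N(B) ∩ ker eval ⊆ KZ.relations`).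
[Kontsevich–Zagier 2001, §1.2; Huber–Müller-Stach 2017, §13.1] [folklore] -/
theorem assembly_proof :
    Summit.KontsevichZagierPeriods.KontsevichZagierPeriods.Theses.HermiteRigidity.Assembly := by
  unfold Summit.KontsevichZagierPeriods.KontsevichZagierPeriods.Theses.HermiteRigidity.Assembly
  intro hX
  -- The route file of the (closed, served) route HermiteRigidity no longer carries its deciding
  -- theorem `closes : ReductionRigidity → RigidKernel → KontsevichZagierPeriods` (rev 4, D-0027
  -- §2.1); its 20-line deduction is inlined here verbatim in content, fed with `rigidKernel_proof`.
  have hK := Summit.KontsevichZagierPeriods.HermiteRigidity.RigidKernel.rigidKernel_proof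
  unfold Summit.KontsevichZagierPeriods.KontsevichZagierPeriods.Theses.HermiteRigidity.RigidKernel
    at hK
  obtain ⟨B, hrig, hred⟩ := hX
  rw [KontsevichZagierPeriods_iff]
  intro n m r r' hr hr' hv
  obtain ⟨x, hxN, hx⟩ := hred n r hr
  obtain ⟨x', hx'N, hx'⟩ := hred m r' hr'
  -- soundness of the calculus: `eval x = value r`, `eval x' = value r'`
  have h1 := (AddMonoidHom.mem_ker).1
    (Literature.NumberTheory.Transcendental.KZ.relations_le_ker_eval_holds hx)
  have h2 := (AddMonoidHom.mem_ker).1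
    (Literature.NumberTheory.Transcendental.KZ.relations_le_ker_eval_holds hx')
  rw [map_sub, Literature.NumberTheory.Transcendental.KZ.eval_of, sub_eq_zero] at h1 h2
  -- `x − x' ∈ N(B) ∩ ker eval ⊆ relations` by RIGIDITY ⇒ KERNEL
  have hxx' : x - x' ∈ Literature.NumberTheory.Transcendental.KZ.relations := by
    refine hK B hrig (x - x') (sub_mem hxN hx'N) ?_
    rw [map_sub, ← h1, ← h2, hv, sub_self]
  -- `[r] − [r'] = ([r] − x) − ([r'] − x') + (x − x')`
  show Literature.NumberTheory.Transcendental.KZ.of r - Literature.NumberTheory.Transcendental.KZ.of r'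
      ∈ Literature.NumberTheory.Transcendental.KZ.relations
  have hsplit : Literature.NumberTheory.Transcendental.KZ.of r
        - Literature.NumberTheory.Transcendental.KZ.of r' =
      (Literature.NumberTheory.Transcendental.KZ.of r - x)
        - (Literature.NumberTheory.Transcendental.KZ.of r' - x') + (x - x') := by
    abel
  rw [hsplit]
  exact add_mem (sub_mem hx hx') hxx'

end Summit.KontsevichZagierPeriods.HermiteRigidity.Assembly
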